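import Literature.NumberTheory.EllipticCurves.Kato2004.EulerSystemTatePairingValuesTwo
import Literature.NumberTheory.EllipticCurves.Kato2004.IwasawaCohomologyCoeffNewform
import Literature.NumberTheory.EllipticCurves.Kato2004.IwasawaCohomologyCoeff
import Literature.NumberTheory.EllipticCurves.CyclotomicLayerRhoTatePairingPk
import Literature.NumberTheory.EllipticCurves.Kobayashi2003.SignedSelmer
import Literature.NumberTheory.EllipticCurves.SharpFlatPAdicLFunctionCoeffField
import Literature.NumberTheory.EllipticCurves.GreenbergVatsal2000.GreenbergSelmerGroups
import Literature.NumberTheory.EllipticCurves.GreenbergSelmer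
import Literature.NumberTheory.EllipticCurves.MazurTateElementCoeffField
import Literature.NumberTheory.EllipticCurves.GlobalMinimalModel
import Literature.NumberTheory.EllipticCurves.FormalGroupChart
import Literature.NumberTheory.GaloisRepresentations.ContinuousH1
import Mathlib.NumberTheory.DirichletCharacter.GaussSum
import Mathlib.NumberTheory.Padics.Complex
import HarnessLib

/-!
# Sketch (stub-ideation k = 3, g28), companion file — `Kato125ρ_Lit` PIN-FREE, importing ONLY `Literature.*` + Mathlib

The typability claim of card `stub-cmlambdalower-k3-g28` made checkable: the `Prop` below is child A's print input (Kato Thm 12.5 (1) at `p = 2`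
with `𝒪_λ`-coefficients, read through Bloch–Kato §3 and the pins) in the SHAPE a Literature typer can state — every pins field of
`OnePairPins` that the clauses use is ∀-bound (`v hv t₀ ht₀ nb bO bO' hbO ζ hζ ePk hμPk hadd₁Pk hadd₂Pk hgalPk hePk pair hpair`, and `Θ hΘ I` at
the place `v`), the frame is `(Φ, φ, hΦφ, ζ₂, hζ₂, τ, hτ)`, and the (BKρ)/(VALρ) bodies are the Literature re-displays of the card's table
(formal-group carrier condition, formal logarithm of `W ⊗ ℚ₂` at `z(Q₀)`, Gauss-sum root `ζ₂ (m+2)`); (TRIVρ) and (ND) are verbatim.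
NO `Summits.*` import. A `def … : Prop` only — nothing is asserted, no `sorry`, no instance/notation/attribute; BSD is not proved by anything here.
This is NOT a proposal and NOT the typer's file (binder pruning per the card's Plan 2 and the docstring derivation are the typer's job);
it exists to show the shape ELABORATES outside `Summits`. [cite: Kato2004Asterisque, Thm. 12.5 (1), 12.6 (pp. 221–223), §15.16 (p. 265)]
[cite: BlochKato1990, §3 (3.10.1), (3.11)]
-/

set_option autoImplicit false
set_option linter.dupNamespace false
set_option backward.isDefEq.respectTransparency false

noncomputable section

open scoped Classical NumberField TensorProduct

namespace Literature.NumberTheory.EllipticCurves.Kato2004.SideaK3G28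

open Field IsDedekindDomain NumberField
open Literature.NumberTheory.GaloisRepresentations
open Literature.NumberTheory.EllipticCurves Literature.NumberTheory.EllipticCurves.ModularForms
open Literature.NumberTheory.EllipticCurves.GreenbergSelmer GreenbergVatsal2000 Kobayashi2003 Rat.HeightOneSpectrum PowerSeries
open Literature.NumberTheory.EllipticCurves.FormalGroupChart

set_option maxHeartbeats 1600000 in
/-- **`Kato125ρ_Lit` (pin-free shape; Literature + Mathlib vocabulary only).** See the module docstring. Nothing asserted.
[cite: Kato2004Asterisque, Thm. 12.5 (1) (pp. 221–222)] [cite: BlochKato1990, §3 (3.10.1), (3.11)] -/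
def Kato125CoeffTwoLitShape : Prop :=
  ∀ (v : HeightOneSpectrum (𝓞 ℚ)) (hv : ((2 : ℕ) : 𝓞 ℚ) ∈ v.asIdeal)
    (W : WeierstrassCurve ℚ) [W.IsElliptic] [W.IsGloballyMinimal]
    (κ : ZpExtension ℚ 2) (γ : absoluteGaloisGroup ℚ), κ.IsCyclotomic → κ.IsTopGenerator γ →
  ∀ (M : ℕ) [NeZero M] (g : CuspForm (CongruenceSubgroup.Gamma0 M) 2) (ι : coeffField g →+* PadicAlgCl 2) (Ω : ℂ),
    IsNewform0 g → cuspCoeff g 2 = 0 → IsCohomologicalPlusPeriod g ι Ω →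
  ∀ (n : ℕ) (ρ : FramedGaloisRep ℚ ↥(padicCoeffIntegers (Set.range ι)) 2),
    (∀ v' : HeightOneSpectrum (𝓞 ℚ), ¬ natGenerator v' ∣ 2 * M → ρ.IsUnramifiedAt v' ∧
      ∃ P : Polynomial ↥(padicCoeffIntegers (Set.range ι)),
        P.map (padicCoeffIntegers (Set.range ι)).subtype =
          Polynomial.X ^ 2 - Polynomial.C (embCoeff g ι (natGenerator v')) * Polynomial.X + Polynomial.C ((natGenerator v' : ℕ) : PadicAlgCl 2) ∧
        ρ.HasFrobCharpolyAt v' P) →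
  ∀ (Θ : Cofree ρ ↥(padicCoeffField (Set.range ι)) ≃+ (Fin n → ↥(W.geomPrimaryTorsion 2)))
    (hΘ : ∀ (δ : absoluteGaloisGroup (v.adicCompletion ℚ)) (m : Cofree ρ ↥(padicCoeffField (Set.range ι))) (i : Fin n),
      Θ (resGalOfEmb (closureEmb (K := ℚ) (v.adicCompletion ℚ)) δ • m) i = resGalOfEmb (closureEmb (K := ℚ) (v.adicCompletion ℚ)) δ • Θ m i)
    (t₀ : ↥(padicCoeffIntegers (Set.range ι)) →+ ℤ_[2])
    (_ht₀ : ∀ (c : ℤ_[2]) (a : ↥(padicCoeffIntegers (Set.range ι))), t₀ (padicIntToCoeffIntegers (Set.range ι) c * a) = c * t₀ a)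
    (nb : ℕ) (bO bO' : Fin nb → ↥(padicCoeffIntegers (Set.range ι)))
    (_hbO : ∀ a : ↥(padicCoeffIntegers (Set.range ι)), a = ∑ i, padicIntToCoeffIntegers (Set.range ι) (t₀ (a * bO' i)) * bO i)
    (ζ : ℕ → AlgebraicClosure ℚ) (_hζ : ∀ k, IsPrimitiveRoot (ζ k) (2 ^ k))
    (ePk : ∀ k : ℕ, ↥(AddSubgroup.torsionBy (Cofree ρ ↥(padicCoeffField (Set.range ι))) ((2 ^ k : ℕ) : ℤ)) →
      ↥(AddSubgroup.torsionBy (Cofree ρ ↥(padicCoeffField (Set.range ι))) ((2 ^ k : ℕ) : ℤ)) → AlgebraicClosure ℚ)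
    (hμPk : ∀ k a b, ePk k a b ^ (2 ^ k) = 1)
    (hadd₁Pk : ∀ k a₁ a₂ b, ePk k (a₁ + a₂) b = ePk k a₁ b * ePk k a₂ b)
    (hadd₂Pk : ∀ k a b₁ b₂, ePk k a (b₁ + b₂) = ePk k a b₁ * ePk k a b₂)
    (hgalPk : ∀ k (σ : absoluteGaloisGroup ℚ)
      (a b : ↥(AddSubgroup.torsionBy (Cofree ρ ↥(padicCoeffField (Set.range ι))) ((2 ^ k : ℕ) : ℤ))),
      σ • ePk k a b = ePk k (cofreeTorsionGaloisModule (Set.range ι) ρ _ σ a) (cofreeTorsionGaloisModule (Set.range ι) ρ _ σ b))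
    (_hePk : ∀ k (s t : Fin 2 → ↥(padicCoeffIntegers (Set.range ι))),
      ePk k (divPowCofreeMkTorsion (Set.range ι) ρ k s) (divPowCofreeMkTorsion (Set.range ι) ρ k t) =
        ζ k ^ (PadicInt.toZModPow k (t₀ (s 0 * t 1 - s 1 * t 0))).val)
    (I : IwasawaH1DataCoeff (FramedGaloisRep.toGaloisRep ρ) 2 κ γ) [Module ↥(padicCoeffIntegers (Set.range ι)) I.H]
    [IsScalarTower ↥(padicCoeffIntegers (Set.range ι)) (IwasawaAlgebraO (Set.range ι)) I.H],
    (∀ (a : ↥(padicCoeffIntegers (Set.range ι))) (x : I.H), a • x = (PowerSeries.C a : IwasawaAlgebraO (Set.range ι)) • x) →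
  ∀ (pair : ∀ m : ℕ, H1 (FramedGaloisRep.toGaloisRep ρ) (κ.layerSubgroup m) →+
      ((Fin n → ↥(localLayerPointsOfEmb κ (closureEmb (K := ℚ) (v.adicCompletion ℚ)) W m)) →+ ℤ_[2])),
    (∀ (m k : ℕ) (x : H1 (FramedGaloisRep.toGaloisRep ρ) (κ.layerSubgroup m))
      (Q : Fin n → ↥(localLayerPointsOfEmb κ (closureEmb (K := ℚ) (v.adicCompletion ℚ)) W m)),
      PadicInt.toZModPow k (pair m x Q) =
        CyclotomicLayer.rhoLayerPairingPk (Set.range ι) ρ W ePk hμPk hadd₁Pk hadd₂Pk hgalPk Θ κ v hΘ m k x Q) →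
  -- the `2`-adic frame: `Φ` over `φ`, a PRIMITIVE root tower `ζ₂` in `ℚ̄₂`, Galois lifts `τ` tied to it
  ∀ (Φ : AlgebraicClosure ℚ_[2] ≃ₐ[ℚ] AlgebraicClosure (v.adicCompletion ℚ)) (φ : ℚ_[2] ≃+* v.adicCompletion ℚ),
    (∀ y : ℚ_[2], Φ (algebraMap ℚ_[2] (AlgebraicClosure ℚ_[2]) y) =
      algebraMap (v.adicCompletion ℚ) (AlgebraicClosure (v.adicCompletion ℚ)) (φ y)) →
  ∀ (ζ₂ : ℕ → PadicAlgCl 2) (hζ₂ : ∀ k : ℕ, IsPrimitiveRoot (ζ₂ k) (2 ^ k))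
    (τ : ∀ m : ℕ, ZMod (2 ^ m) → absoluteGaloisGroup ℚ_[2]),
    (∀ (m : ℕ) (a : ZMod (2 ^ m)), IsUnit a → τ m a • ζ₂ m = ζ₂ m ^ a.val) →
  ∃ (z : I.H) (c' : Fin n → ↥(padicCoeffIntegers (Set.range ι))) (w : ℕ → Fin nb → PadicAlgCl 2) (q : PadicAlgCl 2)
    (μt : IwasawaAlgebraO (Set.range ι)),
    q ≠ 0 ∧ μt ≠ 0 ∧
    -- (ND)
    Function.Injective (fun (a : ↥(padicCoeffIntegers (Set.range ι))) (i : Fin n) => t₀ (c' i * a)) ∧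
    -- (BKρ-Lit)
    (∀ (a : ↥(padicCoeffIntegers (Set.range ι))) (m : ℕ) (i : Fin n) (Q₀ : localPoints W ℚ_[2])
      (hQv : WeierstrassCurve.Affine.Point.map (W' := W)
          (Φ : AlgebraicClosure ℚ_[2] →ₐ[ℚ] AlgebraicClosure (v.adicCompletion ℚ))
          (show (W.baseChange (AlgebraicClosure ℚ_[2])).toAffine.Point from Q₀) ∈
        localLayerPointsOfEmb κ (closureEmb (K := ℚ) (v.adicCompletion ℚ)) W m),
      (∀ (X Y : AlgebraicClosure ℚ_[2]) (hXY : (W.baseChange (AlgebraicClosure ℚ_[2])).toAffine.Nonsingular X Y),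
          (show (W.baseChange (AlgebraicClosure ℚ_[2])).toAffine.Point from Q₀) = .some X Y hXY → 1 < Valued.v X) →
      algebraMap ℚ_[2] (PadicAlgCl 2)
          ((pair m (I.proj m ((PowerSeries.C a : IwasawaAlgebraO (Set.range ι)) • z)) (Pi.single i ⟨_, hQv⟩) : ℤ_[2]) : ℚ_[2]) =
        ∑ j : Fin nb, algebraMap ℚ_[2] (PadicAlgCl 2) ((t₀ (c' i * a * bO j) : ℤ_[2]) : ℚ_[2]) *
          ∑ b : (ZMod (2 ^ (m + 2)))ˣ, τ (m + 2) (b : ZMod (2 ^ (m + 2))) •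
            ((∑' l : ℕ, algebraMap ℚ_[2] (PadicAlgCl 2) (PowerSeries.coeff l (W.map (algebraMap ℚ ℚ_[2])).formalLog) *
                (WeierstrassCurve.Affine.Point.zCoord (show (W.baseChange (AlgebraicClosure ℚ_[2])).toAffine.Point from Q₀)) ^ l) *
              w (m + 2) j)) ∧
    -- (VALρ-Lit)
    (∀ (m : ℕ) (ψ : DirichletCharacter (PadicAlgCl 2) (2 ^ (m + 2))), ψ (-1) = 1 → ψ.IsPrimitive →
      algebraMap (PadicAlgCl 2) ℂ_[2]
          ((∑ j : Fin nb, ((bO j : ↥(padicCoeffIntegers (Set.range ι))) : PadicAlgCl 2) *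
              ∑ b : (ZMod (2 ^ (m + 2)))ˣ, ψ⁻¹ (b : ZMod (2 ^ (m + 2))) * τ (m + 2) (b : ZMod (2 ^ (m + 2))) • w (m + 2) j) *
            gaussSum ψ (AddChar.zmodChar (2 ^ (m + 2)) ((hζ₂ (m + 2)).pow_eq_one))) =
        algebraMap (PadicAlgCl 2) ℂ_[2] q *
          (∑' k, algebraMap (PadicAlgCl 2) ℂ_[2] ((PowerSeries.coeff k μt : ↥(padicCoeffIntegers (Set.range ι))) : PadicAlgCl 2) *
              (algebraMap (PadicAlgCl 2) ℂ_[2] (ψ (5 : ZMod (2 ^ (m + 2)))) - 1) ^ k) *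
          algebraMap (PadicAlgCl 2) ℂ_[2]
            (∑ a : ZMod (2 ^ (m + 2)), ψ a * ι (plusSymbolK g Ω ((a.val : ℚ) / (2 : ℚ) ^ (m + 2))))) ∧
    -- (TRIVρ)
    (∀ k : ℕ, 2 ≤ k → k ≤ 3 →
      ∑ j : Fin nb, ((bO j : ↥(padicCoeffIntegers (Set.range ι))) : PadicAlgCl 2) * ∑ b : (ZMod (2 ^ k))ˣ, τ k (b : ZMod (2 ^ k)) • w k j =
        (3 / 2 : PadicAlgCl 2) * q * ((PowerSeries.coeff 0 μt : ↥(padicCoeffIntegers (Set.range ι))) : PadicAlgCl 2) * ι (plusSymbolK g Ω 0))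

end Literature.NumberTheory.EllipticCurves.Kato2004.SideaK3G28

end
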